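import Mathlib

/-!
# `TateLifting` (stmt-KontsevichZagierPeriods-9129), line `Sketch` — stub 48 `IsotropyPlane`,
# auxiliary file: the block Jacobian and the tan-half-angle functions

Auxiliary lemmas for `Theorems/InverseLandauTateLiftingIsotropyPlane.lean` (the plane engine of
hard-disc cluster integrals = `IsotropyFactorisation2` of route HardSphereVirial, one rule-(2) move
of the Kontsevich–Zagier calculus along the tan-half-angle chart
`Ψ(u, ρ, y₂, y₃) = (ρ c, ρ s, R y₂, R y₃)`, `c = (1 − u²)/(1 + u²)`, `s = 2u/(1 + u²)`,
`R = (c, −s; s, c)`):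

* the `6 × 6` Jacobian of `Ψ` in block form `(A, 0; C, R ⊕ R)` (`Matrix.fromBlocks` along
  `finSumFinEquiv : Fin 2 ⊕ Fin 4 ≃ Fin 6`): its determinant `det A · (c² + s²)²`
  (`det_blockJac`, by `Matrix.det_fromBlocks_zero₁₂` twice) and its action on vectors
  (`blockJac_mulVec`); `2 × 2` rotations are orthogonal (`rot_transpose_mul_self`);
* the half-angle functions, kept abstract as `c s c' s' : ℝ → ℝ` constrained by their defining
  equations: `c² + s² = 1`, injectivity and surjectivity onto the circle minus `(−1, 0)` of
  `u ↦ (c, s)(u)`, polar coordinates off the closed non-positive axis (`polar_exists`), the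
  derivatives `c′ = −4u/(1+u²)²`, `s′ = (2 − 2u²)/(1+u²)²`, and the `2 × 2` Jacobian determinant
  `ρ (c′ s − c s′) = −2ρ/(1 + u²)` of `(u, ρ) ↦ (ρ c, ρ s)`.

No definitions are introduced (pure proof file). References: M. Kontsevich, D. Zagier, *Periods*
(2001), §1.2 rule (2); the rest is folklore calculus and linear algebra.
-/

noncomputable section

namespace Summit.KontsevichZagierPeriods.InverseLandau

namespace IsotropyPlane

/-! ### Linear algebra of the block Jacobian -/

/-- `finSumFinEquiv.symm` on `Fin 6 = Fin (2 + 4)`, evaluated. [folklore] -/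
theorem finSumFinEquiv_symm_six (k : Fin 6) : (finSumFinEquiv.symm k : Fin 2 ⊕ Fin 4) =
    (![Sum.inl 0, Sum.inl 1, Sum.inr 0, Sum.inr 1, Sum.inr 2, Sum.inr 3] :
      Fin 6 → Fin 2 ⊕ Fin 4) k := by
  revert k
  decide

/-- `finSumFinEquiv.symm` on `Fin 4 = Fin (2 + 2)`, evaluated. [folklore] -/
theorem finSumFinEquiv_symm_four (k : Fin 4) : (finSumFinEquiv.symm k : Fin 2 ⊕ Fin 2) =
    (![Sum.inl 0, Sum.inl 1, Sum.inr 0, Sum.inr 1] : Fin 4 → Fin 2 ⊕ Fin 2) k := by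
  revert k
  decide

/-- Determinant of the block lower-triangular `6 × 6` matrix `(A, 0; C, R ⊕ R)` with
`R = (p, −q; q, p)`: `det A · (p² + q²)²`. [folklore] -/
theorem det_blockJac (a b c d k₀ k₁ k₂ k₃ p q : ℝ) :
    (Matrix.reindex finSumFinEquiv finSumFinEquiv
        (Matrix.fromBlocks !![a, b; c, d] 0 !![k₀, 0; k₁, 0; k₂, 0; k₃, 0]
          (Matrix.reindex finSumFinEquiv finSumFinEquiv
            (Matrix.fromBlocks !![p, -q; q, p] 0 0 !![p, -q; q, p]))) :
        Matrix (Fin 6) (Fin 6) ℝ).det = (a * d - b * c) * (p ^ 2 + q ^ 2) ^ 2 := by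
  rw [Matrix.det_reindex_self, Matrix.det_fromBlocks_zero₁₂, Matrix.det_reindex_self,
    Matrix.det_fromBlocks_zero₁₂, Matrix.det_fin_two_of, Matrix.det_fin_two_of]
  ring

/-- The block lower-triangular `6 × 6` matrix `(A, 0; C, R ⊕ R)` applied to a vector. [folklore] -/
theorem blockJac_mulVec (a b c d k₀ k₁ k₂ k₃ p q : ℝ) (v : Fin 6 → ℝ) :
    (Matrix.reindex finSumFinEquiv finSumFinEquiv
        (Matrix.fromBlocks !![a, b; c, d] 0 !![k₀, 0; k₁, 0; k₂, 0; k₃, 0]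
          (Matrix.reindex finSumFinEquiv finSumFinEquiv
            (Matrix.fromBlocks !![p, -q; q, p] 0 0 !![p, -q; q, p]))) :
        Matrix (Fin 6) (Fin 6) ℝ).mulVec v =
      ![a * v 0 + b * v 1, c * v 0 + d * v 1, k₀ * v 0 + (p * v 2 - q * v 3),
        k₁ * v 0 + (q * v 2 + p * v 3), k₂ * v 0 + (p * v 4 - q * v 5),
        k₃ * v 0 + (q * v 4 + p * v 5)] := by
  funext i
  fin_cases i <;> simp [Matrix.mulVec, dotProduct, Fin.sum_univ_succ, finSumFinEquiv_symm_six,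
    finSumFinEquiv_symm_four] <;> ring

/-- A `2 × 2` matrix applied to a vector. [folklore] -/
theorem mulVec_two (a b c d p q : ℝ) :
    (!![a, b; c, d] : Matrix (Fin 2) (Fin 2) ℝ).mulVec ![p, q] = ![a * p + b * q, c * p + d * q] := by
  funext i
  fin_cases i <;> simp [Matrix.mulVec, dotProduct, Fin.sum_univ_two]

/-- Rotation matrices are orthogonal: `Rᵀ R = 1` for `R = (p, −q; q, p)`, `p² + q² = 1`.
[folklore] -/
theorem rot_transpose_mul_self (p q : ℝ) (h : p ^ 2 + q ^ 2 = 1) :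
    (!![p, -q; q, p] : Matrix (Fin 2) (Fin 2) ℝ).transpose * !![p, -q; q, p] = 1 := by
  ext i j
  fin_cases i <;> fin_cases j <;> simp [Matrix.mul_apply, Fin.sum_univ_two] <;> nlinarith [h]

/-! ### The tan-half-angle functions `c = (1 − u²)/(1 + u²)`, `s = 2u/(1 + u²)` -/

section HalfAngle

variable {c s c' s' : ℝ → ℝ}
  (hc : ∀ u, c u = (1 - u ^ 2) / (1 + u ^ 2)) (hs : ∀ u, s u = 2 * u / (1 + u ^ 2))
  (hc' : ∀ u, c' u = -(4 * u) / (1 + u ^ 2) ^ 2)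
  (hs' : ∀ u, s' u = (2 - 2 * u ^ 2) / (1 + u ^ 2) ^ 2)

include hc hs in
/-- Pythagoras for the half-angle pair: `c² + s² = 1`. [folklore] -/
theorem halfAngle_sq_add_sq (u : ℝ) : c u ^ 2 + s u ^ 2 = 1 := by
  rw [hc, hs]
  have h : (1 : ℝ) + u ^ 2 ≠ 0 := by positivity
  field_simp
  ring

include hc in
/-- `c(0) = 1`. [folklore] -/
theorem halfAngle_c_zero : c 0 = 1 := by
  rw [hc]
  norm_num

include hs in
/-- `s(u) = 0` only for `u = 0`. [folklore] -/
theorem halfAngle_s_eq_zero {u : ℝ} (h : s u = 0) : u = 0 := by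
  rw [hs, div_eq_zero_iff] at h
  rcases h with h | h
  · linarith
  · have hu0 : (1 : ℝ) + u ^ 2 ≠ 0 := by positivity
    exact absurd h hu0

include hc hs in
/-- The half-angle parametrisation is injective: `(c, s)(u) = (c, s)(u′) ⇒ u = u′`. [folklore] -/
theorem halfAngle_inj {u u' : ℝ} (h1 : c u = c u') (h2 : s u = s u') : u = u' := by
  have hu0 : (1 : ℝ) + u ^ 2 ≠ 0 := by positivity
  have hu0' : (1 : ℝ) + u' ^ 2 ≠ 0 := by positivity
  rw [hc, hc, div_eq_div_iff hu0 hu0'] at h1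
  rw [hs, hs, div_eq_div_iff hu0 hu0'] at h2
  have hsq : u ^ 2 = u' ^ 2 := by linear_combination (-1 / 2 : ℝ) * h1
  have h3 : (u - u') * (1 + u ^ 2) = 0 := by linear_combination (1 / 2 : ℝ) * h2 + u * hsq
  rcases mul_eq_zero.1 h3 with h | h
  · linarith
  · exact absurd h hu0

include hc hs in
/-- The half-angle parametrisation is onto the circle minus `(−1, 0)`:
`(c, s)(q/(1 + p)) = (p, q)` for `p² + q² = 1`, `p ≠ −1`. [folklore] -/
theorem halfAngle_surj {p q : ℝ} (h : p ^ 2 + q ^ 2 = 1) (hp : p ≠ -1) :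
    c (q / (1 + p)) = p ∧ s (q / (1 + p)) = q := by
  have hp1 : 1 + p ≠ 0 := fun h' => hp (by linarith)
  have hu : (1 : ℝ) + (q / (1 + p)) ^ 2 ≠ 0 := by positivity
  constructor
  · rw [hc, div_eq_iff hu]
    field_simp
    linear_combination (-(1 + p)) * h
  · rw [hs, div_eq_iff hu]
    field_simp
    linear_combination (-q) * h

include hc hs in
/-- Polar/half-angle coordinates off the closed non-positive axis: for `¬(b = 0 ∧ a ≤ 0)` there
are `u` and `ρ > 0` with `(a, b) = ρ (c(u), s(u))` (`ρ = √(a² + b²)`, `u = b/(ρ + a)`). [folklore] -/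
theorem polar_exists (a b : ℝ) (h : ¬(b = 0 ∧ a ≤ 0)) :
    ∃ u ρ : ℝ, 0 < ρ ∧ a = ρ * c u ∧ b = ρ * s u := by
  set ρ := Real.sqrt (a ^ 2 + b ^ 2) with hρ_def
  have hρ0 : 0 ≤ ρ := Real.sqrt_nonneg _
  have hρ2 : ρ ^ 2 = a ^ 2 + b ^ 2 := Real.sq_sqrt (by positivity)
  have hρ : 0 < ρ := by
    rcases hρ0.lt_or_eq with hlt | heq
    · exact hlt
    · exfalso
      rw [← heq] at hρ2
      have ha2 : a ^ 2 = 0 := by nlinarith [sq_nonneg a, sq_nonneg b]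
      have hb2 : b ^ 2 = 0 := by nlinarith [sq_nonneg a, sq_nonneg b]
      exact h ⟨pow_eq_zero_iff two_ne_zero |>.1 hb2, (pow_eq_zero_iff two_ne_zero |>.1 ha2).le⟩
  have hp : a / ρ ≠ -1 := by
    intro hp
    rw [div_eq_iff hρ.ne'] at hp
    have hb2 : b ^ 2 = 0 := by nlinarith [hρ2]
    exact h ⟨pow_eq_zero_iff two_ne_zero |>.1 hb2, by nlinarith⟩
  have h1 : (a / ρ) ^ 2 + (b / ρ) ^ 2 = 1 := by
    field_simp
    linear_combination -hρ2
  obtain ⟨hcu, hsu⟩ := halfAngle_surj hc hs h1 hp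
  refine ⟨b / ρ / (1 + a / ρ), ρ, hρ, ?_, ?_⟩
  · rw [hcu]
    field_simp
  · rw [hsu]
    field_simp

include hc hc' in
/-- `c′ = −4u/(1 + u²)²`. [folklore] -/
theorem hasDerivAt_halfAngle_c (u : ℝ) : HasDerivAt c (c' u) u := by
  rw [show c = fun v => (1 - v ^ 2) / (1 + v ^ 2) from funext hc, hc']
  have h1 : HasDerivAt (fun v : ℝ => 1 - v ^ 2) (-(2 * u)) u := by
    simpa using (hasDerivAt_pow 2 u).const_sub 1
  have h2 : HasDerivAt (fun v : ℝ => 1 + v ^ 2) (2 * u) u := by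
    simpa using (hasDerivAt_pow 2 u).const_add 1
  refine (h1.div h2 (by positivity)).congr_deriv ?_
  field_simp
  ring

include hs hs' in
/-- `s′ = (2 − 2u²)/(1 + u²)²`. [folklore] -/
theorem hasDerivAt_halfAngle_s (u : ℝ) : HasDerivAt s (s' u) u := by
  rw [show s = fun v => 2 * v / (1 + v ^ 2) from funext hs, hs']
  have h1 : HasDerivAt (fun v : ℝ => 2 * v) 2 u := by
    simpa using (hasDerivAt_id u).const_mul (2 : ℝ)
  have h2 : HasDerivAt (fun v : ℝ => 1 + v ^ 2) (2 * u) u := by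
    simpa using (hasDerivAt_pow 2 u).const_add 1
  refine (h1.div h2 (by positivity)).congr_deriv ?_
  field_simp
  ring

include hc hs hc' hs' in
/-- The `2 × 2` Jacobian `(ρ c′, c; ρ s′, s)` of `(u, ρ) ↦ (ρ c, ρ s)` has determinant
`−2ρ/(1 + u²)`. [folklore] -/
theorem det_polarBlock (u ρ : ℝ) :
    ρ * c' u * s u - c u * (ρ * s' u) = -(2 * ρ / (1 + u ^ 2)) := by
  rw [hc, hs, hc', hs']
  have h : (1 : ℝ) + u ^ 2 ≠ 0 := by positivity
  field_simp
  ring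

end HalfAngle

end IsotropyPlane

/-- **Registered auxiliary sub-goal of stub 48 `IsotropyPlane` (half-angle polar coordinates).**
Off the closed non-positive axis, every point of the plane is `ρ (c(u), s(u))` with `ρ > 0`,
`c(u) = (1 − u²)/(1 + u²)`, `s(u) = 2u/(1 + u²)` (`ρ = √(a² + b²)`, `u = b/(ρ + a)` — the
inverse of the tan-half-angle chart of the plane engine; `IsotropyPlane.polar_exists`). [folklore] -/
theorem tateLifting_isotropyPlanePolar :
    ∀ (a b : ℝ), ¬(b = 0 ∧ a ≤ 0) →
      ∃ u ρ : ℝ, 0 < ρ ∧ a = ρ * ((1 - u ^ 2) / (1 + u ^ 2)) ∧ b = ρ * (2 * u / (1 + u ^ 2)) :=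
  fun a b h => IsotropyPlane.polar_exists (c := fun u => (1 - u ^ 2) / (1 + u ^ 2))
    (s := fun u => 2 * u / (1 + u ^ 2)) (fun _ => rfl) (fun _ => rfl) a b h

end Summit.KontsevichZagierPeriods.InverseLandau

end
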